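import Mathlib
import Literature.RingTheory.MvPolynomial.KaltofenBoundsDegreeTools

/-!
# Radical membership `f ∈ √I ⇔ 1 ∈ ⟨f₁, …, f_s, 1 − y f⟩` and Hilbert's Nullstellensatz from the
# weak one via `Ĩ` (Cox–Little–O'Shea, Ch. 4 §2 Prop. 8 and §1 Thm. 2)

[cite: CoxLittleOShea2007, Ch.4 §2 Prop. 8 (Radical Membership); Ch.4 §1 Thm. 1 (The Weak Nullstellensatz), Thm. 2
(Hilbert's Nullstellensatz) with its proof: the ideal Ĩ, the claim V(Ĩ) = ∅ and eqs. (2)–(4) (numbering as in the held text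
`book:cox2007-ideals-varieties-algorithms-…`, chunks p0174–p0178 and p0182–p0184)]

Cox–Little–O'Shea, *Ideals, Varieties, and Algorithms* (3rd ed., Springer UTM 2007), Chapter 4 §2,
**Proposition 8 (Radical Membership).** Let `k` be an arbitrary field and `I = ⟨f₁, …, f_s⟩ ⊆ k[x₁, …, xₙ]`.
Then `f ∈ √I` if and only if the constant polynomial `1` belongs to the ideal
`Ĩ = ⟨f₁, …, f_s, 1 − y f⟩ ⊆ k[x₁, …, xₙ, y]`, in which case `Ĩ = k[x₁, …, xₙ, y]` (the *Rabinowitsch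
trick*; it yields the book's *radical membership algorithm*: `f ∈ √I` iff the reduced Gröbner basis
of `Ĩ` is `{1}` — the Gröbner-basis half is not formalised here).

We prove the statement for an ideal `I` of an arbitrary commutative ring `R` in place of
`k[x₁, …, xₙ]`, with the new variable `y` realised as the variable of `R[y] = Polynomial R`, so that
`Ĩ = I·R[y] + ⟨1 − y f⟩` (`Ideal.map C I ⊔ Ideal.span {1 - X * C f}`):

* `one_mem_rabinowitsch_of_mem_radical` — (⇐ of Prop. 8) `f ∈ √I ⇒ 1 ∈ Ĩ`, by the book's identity
  `1 = yᵐ fᵐ + (1 − y f)(1 + y f + ⋯ + yᵐ⁻¹ fᵐ⁻¹)` (`one_sub_pow_mem_span_one_sub`);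
* `exists_pow_mem_of_one_mem_rabinowitsch` — (⇒ of Prop. 8, i.e. eqs. (2)–(4) of §1: substitute `y = 1/f` and clear
  denominators) `1 ∈ Ĩ ⇒ fᵐ ∈ I` for some `m`; we substitute `y ↦ 1/f` by mapping `R[y]` to the
  localisation `R[1/f]` (`aeval_invSelf_one_sub_X_mul_C`, `map_algebraMap_away_eq_top_of_one_mem_rabinowitsch`),
  where `I·R[1/f] = R[1/f]` means exactly that a power of `f` lies in `I`;
* `mem_radical_iff_one_mem_rabinowitsch`, `mem_radical_iff_rabinowitsch_eq_top` — Proposition 8 and its "in which case" clause;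
* `mem_radical_span_iff_one_mem_span` — the book's form with generators: `f ∈ √⟨S⟩ ⇔ 1 ∈ ⟨C '' S, 1 − y f⟩`;
* `zeroLocus_rabinowitsch_eq_empty`, `mem_radical_of_weakNullstellensatz`,
  `eq_top_of_zeroLocus_eq_empty`, `exists_pow_mem_of_mem_vanishingIdeal_zeroLocus`
  — Ch. 4 §1: the claim `V(Ĩ) = ∅`, and Thm. 2 (Hilbert's Nullstellensatz, `f ∈ I(V(I)) ⇒ fᵐ ∈ I`) deduced
  from Thm. 1 (the Weak Nullstellensatz, taken as a hypothesis in `n + 1` variables and discharged from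
  Mathlib for `k` algebraically closed) exactly along the book's route `V(Ĩ) = ∅ ⇒ 1 ∈ Ĩ ⇒ fᵐ ∈ I`;
* `mvPolynomial_mem_radical_iff_one_mem_rabinowitsch` — the book's setting verbatim: for
  `I ⊆ k[xᵢ : i ∈ σ]`, `f ∈ √I ⇔ 1 ∈ ⟨I, 1 − y f⟩ ⊆ k[xᵢ, y]` with `k[xᵢ, y] = MvPolynomial (Option σ) k`
  (`y = X none`), transported along Mathlib's `MvPolynomial.optionEquivLeft`.

Mathlib supplies `Ideal.radical`, `Localization.Away`, `IsLocalization.Away.invSelf`,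
`IsLocalization.map_algebraMap_ne_top_iff_disjoint`, `geom_sum_mul_neg` and `MvPolynomial.optionEquivLeft`
(used, not restated); the transport lemma `optionEquivLeft (rename some p) = C p` is the tree's
`Literature.RingTheory.MvPolynomial.KaltofenBounds.optionEquivLeft_rename_some` (imported, not restated). The tree uses the Rabinowitsch presentation of a basic open set in
`Literature/AlgebraicGeometry/Motives/RegularFormLocalization.lean` (regular forms, a different statement)
and refers to Prop. 8 without stating it in `Literature/RingTheory/MvPolynomial/AutomaticGeometricTheoremProving.lean`;
the radical-membership criterion itself is not elsewhere in the tree.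
-/

namespace Literature.RingTheory.Nullstellensatz.RadicalMembership

open Polynomial

section CommRing

variable {R : Type*} [CommRing R]

/-- The book's identity `1 − yᵐ fᵐ = (1 − y f)(1 + y f + ⋯ + yᵐ⁻¹ fᵐ⁻¹)`: `1 − (y f)ᵐ ∈ ⟨1 − y f⟩`.
[cite: CoxLittleOShea2007, Ch.4 §2 Prop. 8 (proof, ⇐)] -/
theorem one_sub_pow_mem_span_one_sub (u : R[X]) (m : ℕ) : 1 - u ^ m ∈ Ideal.span {1 - u} :=
  Ideal.mem_span_singleton'.mpr ⟨∑ i ∈ Finset.range m, u ^ i, geom_sum_mul_neg u m⟩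

/-- `1 − y f ∈ Ĩ`. [cite: CoxLittleOShea2007, Ch.4 §2 Prop. 8 (proof)] -/
theorem one_sub_X_mul_C_mem_rabinowitsch (I : Ideal R) (f : R) :
    1 - X * C f ∈ I.map (C : R →+* R[X]) ⊔ Ideal.span {1 - X * C f} :=
  Ideal.mem_sup_right (Ideal.subset_span rfl)

/-- `I ⊆ Ĩ`: `g ∈ I ⇒ g ∈ Ĩ` (as a constant polynomial in `y`). [cite: CoxLittleOShea2007, Ch.4 §2 Prop. 8 (proof)] -/
theorem C_mem_rabinowitsch_of_mem (I : Ideal R) (f : R) {g : R} (hg : g ∈ I) :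
    C g ∈ I.map (C : R →+* R[X]) ⊔ Ideal.span {1 - X * C f} :=
  Ideal.mem_sup_left (Ideal.mem_map_of_mem _ hg)

/-- If `fᵐ ∈ I` then `1 = yᵐ·fᵐ + (1 − y f)·(1 + y f + ⋯ + yᵐ⁻¹ fᵐ⁻¹) ∈ Ĩ`.
[cite: CoxLittleOShea2007, Ch.4 §2 Prop. 8 (proof, ⇐)] -/
theorem one_mem_rabinowitsch_of_pow_mem (I : Ideal R) {f : R} {m : ℕ} (h : f ^ m ∈ I) :
    (1 : R[X]) ∈ I.map (C : R →+* R[X]) ⊔ Ideal.span {1 - X * C f} := by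
  have h1 : (X * C f) ^ m ∈ I.map (C : R →+* R[X]) ⊔ Ideal.span {1 - X * C f} := by
    rw [mul_pow, ← map_pow]
    exact Ideal.mul_mem_left _ _ (C_mem_rabinowitsch_of_mem I f h)
  have h2 : 1 - (X * C f) ^ m ∈ I.map (C : R →+* R[X]) ⊔ Ideal.span {1 - X * C f} :=
    Ideal.mem_sup_right (one_sub_pow_mem_span_one_sub _ m)
  simpa using Ideal.add_mem _ h1 h2

/-- **Proposition 8, "if" direction** (Cox–Little–O'Shea Ch. 4 §2): `f ∈ √I ⇒ 1 ∈ Ĩ = ⟨I, 1 − y f⟩`.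
[cite: CoxLittleOShea2007, Ch.4 §2 Prop. 8 (⇐)] -/
theorem one_mem_rabinowitsch_of_mem_radical (I : Ideal R) {f : R} (h : f ∈ I.radical) :
    (1 : R[X]) ∈ I.map (C : R →+* R[X]) ⊔ Ideal.span {1 - X * C f} := by
  obtain ⟨m, hm⟩ := Ideal.mem_radical_iff.mp h
  exact one_mem_rabinowitsch_of_pow_mem I hm

/-- The substitution `y ↦ 1/f` (into any localisation `S = R[1/f]`) kills `1 − y f`.
[cite: CoxLittleOShea2007, Ch.4 §1, proof of Thm. 2, eq. (3) (substituting y = 1/f)] -/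
theorem aeval_invSelf_one_sub_X_mul_C (f : R) (S : Type*) [CommRing S] [Algebra R S]
    [IsLocalization.Away f S] :
    aeval (IsLocalization.Away.invSelf (S := S) f) (1 - X * C f) = 0 := by
  rw [map_sub, map_one, map_mul, aeval_X, aeval_C, mul_comm, IsLocalization.Away.mul_invSelf, sub_self]

/-- Substituting `y = 1/f` in a relation `1 = Σ pᵢ fᵢ + q·(1 − y f)` gives `1 ∈ I·R[1/f]`, i.e.
`I·R[1/f] = R[1/f]` (eqs. (2)–(3) of §1). [cite: CoxLittleOShea2007, Ch.4 §1, proof of Thm. 2, eqs. (2)–(3)] -/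
theorem map_algebraMap_away_eq_top_of_one_mem_rabinowitsch (I : Ideal R) (f : R) (S : Type*) [CommRing S]
    [Algebra R S] [IsLocalization.Away f S]
    (h : (1 : R[X]) ∈ I.map (C : R →+* R[X]) ⊔ Ideal.span {1 - X * C f}) :
    I.map (algebraMap R S) = ⊤ := by
  set φ : R[X] →ₐ[R] S := aeval (IsLocalization.Away.invSelf (S := S) f) with hφ
  obtain ⟨a, ha, b, hb, hab⟩ := Submodule.mem_sup.mp h
  obtain ⟨q, rfl⟩ := Ideal.mem_span_singleton'.mp hb
  have hφa : φ a = 1 := by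
    have := congrArg φ hab
    rwa [map_add, map_mul, aeval_invSelf_one_sub_X_mul_C, mul_zero, add_zero, map_one] at this
  have hmem : φ a ∈ (I.map (C : R →+* R[X])).map (φ : R[X] →+* S) := Ideal.mem_map_of_mem _ ha
  rw [Ideal.map_map] at hmem
  have hcomp : (φ : R[X] →+* S).comp C = algebraMap R S := by
    ext r
    simp [hφ]
  rw [hcomp, hφa] at hmem
  exact (Ideal.eq_top_iff_one _).mpr hmem

/-- Clearing denominators (eq. (4) of §1): `I·R[1/f] = R[1/f]` forces `fᵐ ∈ I` for some `m`; hence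
**Proposition 8, "only if" direction**: `1 ∈ Ĩ ⇒ fᵐ ∈ I` for some `m`.
[cite: CoxLittleOShea2007, Ch.4 §2 Prop. 8 (⇒); Ch.4 §1, proof of Thm. 2, eq. (4)] -/
theorem exists_pow_mem_of_one_mem_rabinowitsch (I : Ideal R) {f : R}
    (h : (1 : R[X]) ∈ I.map (C : R →+* R[X]) ⊔ Ideal.span {1 - X * C f}) : ∃ m : ℕ, f ^ m ∈ I := by
  have htop := map_algebraMap_away_eq_top_of_one_mem_rabinowitsch I f (Localization.Away f) h
  have hnd : ¬ Disjoint ((Submonoid.powers f : Submonoid R) : Set R) (I : Set R) := fun hd =>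
    (IsLocalization.map_algebraMap_ne_top_iff_disjoint (Submonoid.powers f) (Localization.Away f) I).mpr
      hd htop
  obtain ⟨x, hx, hxI⟩ := Set.not_disjoint_iff.mp hnd
  obtain ⟨m, rfl⟩ := (Submonoid.mem_powers_iff _ _).mp hx
  exact ⟨m, hxI⟩

/-- **Proposition 8 (Radical Membership)** (Cox–Little–O'Shea Ch. 4 §2), for an ideal `I` of any
commutative ring `R` (the book: `R = k[x₁, …, xₙ]`): `f ∈ √I ⇔ 1 ∈ Ĩ = I·R[y] + ⟨1 − y f⟩ ⊆ R[y]`.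
[cite: CoxLittleOShea2007, Ch.4 §2 Prop. 8] -/
theorem mem_radical_iff_one_mem_rabinowitsch (I : Ideal R) (f : R) :
    f ∈ I.radical ↔ (1 : R[X]) ∈ I.map (C : R →+* R[X]) ⊔ Ideal.span {1 - X * C f} :=
  ⟨one_mem_rabinowitsch_of_mem_radical I, fun h => Ideal.mem_radical_iff.mpr (exists_pow_mem_of_one_mem_rabinowitsch I h)⟩

/-- **Proposition 8, "in which case `Ĩ = k[x₁, …, xₙ, y]`"**: `f ∈ √I ⇔ Ĩ` is the whole ring `R[y]`.
[cite: CoxLittleOShea2007, Ch.4 §2 Prop. 8 (in which case Ĩ = k[x₁, …, xₙ, y])] -/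
theorem mem_radical_iff_rabinowitsch_eq_top (I : Ideal R) (f : R) :
    f ∈ I.radical ↔ I.map (C : R →+* R[X]) ⊔ Ideal.span {1 - X * C f} = ⊤ := by
  rw [mem_radical_iff_one_mem_rabinowitsch, Ideal.eq_top_iff_one]

/-- **Proposition 8 with generators**, as stated in the book: for `I = ⟨f₁, …, f_s⟩` (any generating set
`S`), `f ∈ √I ⇔ 1 ∈ ⟨f₁, …, f_s, 1 − y f⟩ ⊆ R[y]`. [cite: CoxLittleOShea2007, Ch.4 §2 Prop. 8] -/
theorem mem_radical_span_iff_one_mem_span (S : Set R) (f : R) :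
    f ∈ (Ideal.span S).radical ↔
      (1 : R[X]) ∈ Ideal.span ((C : R →+* R[X]) '' S ∪ {1 - X * C f}) := by
  rw [mem_radical_iff_one_mem_rabinowitsch, Ideal.map_span, Ideal.span_union]

end CommRing

end Literature.RingTheory.Nullstellensatz.RadicalMembership

open MvPolynomial

namespace Literature.RingTheory.Nullstellensatz.RadicalMembership

/-! ### The book's setting: `I ⊆ k[x₁, …, xₙ]`, `Ĩ ⊆ k[x₁, …, xₙ, y]` -/

section MvPolynomial

variable {k : Type*} [CommRing k] {σ : Type*}

/-- Transport of `Ĩ`: under `k[xᵢ, y] ≅ k[xᵢ][y]`, the ideal `⟨I, 1 − y f⟩ ⊆ k[xᵢ, y]` goes to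
`I·k[xᵢ][y] + ⟨1 − y f⟩`. [cite: CoxLittleOShea2007, Ch.4 §2 Prop. 8 (the ideal Ĩ)] -/
theorem map_optionEquivLeft_rabinowitsch (I : Ideal (MvPolynomial σ k)) (f : MvPolynomial σ k) :
    (I.map (rename some : MvPolynomial σ k →ₐ[k] MvPolynomial (Option σ) k) ⊔
        Ideal.span {1 - X none * rename some f}).map (optionEquivLeft k σ) =
      I.map (Polynomial.C : MvPolynomial σ k →+* Polynomial (MvPolynomial σ k)) ⊔
        Ideal.span {1 - Polynomial.X * Polynomial.C f} := by
  have hfun : ⇑(((optionEquivLeft k σ : MvPolynomial (Option σ) k ≃ₐ[k] Polynomial (MvPolynomial σ k)) :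
        MvPolynomial (Option σ) k →+* Polynomial (MvPolynomial σ k)).comp
        ((rename some : MvPolynomial σ k →ₐ[k] MvPolynomial (Option σ) k) :
          MvPolynomial σ k →+* MvPolynomial (Option σ) k)) =
      ⇑(Polynomial.C : MvPolynomial σ k →+* Polynomial (MvPolynomial σ k)) :=
    funext fun p => by simp [Literature.RingTheory.MvPolynomial.KaltofenBounds.optionEquivLeft_rename_some p]
  rw [Ideal.map_sup, Ideal.map_span, Set.image_singleton, map_sub, map_one, map_mul,
    optionEquivLeft_X_none, Literature.RingTheory.MvPolynomial.KaltofenBounds.optionEquivLeft_rename_some,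
    ← Ideal.map_coe (rename some : MvPolynomial σ k →ₐ[k] MvPolynomial (Option σ) k) I,
    ← Ideal.map_coe (optionEquivLeft k σ), Ideal.map_map]
  congr 1
  unfold Ideal.map
  rw [hfun]

/-- **Proposition 8 (Radical Membership)** in the book's coordinates: for an ideal
`I ⊆ k[xᵢ : i ∈ σ]` and `f`, with a new variable `y` (`= X none` in `MvPolynomial (Option σ) k`),
`f ∈ √I ⇔ 1 ∈ Ĩ = ⟨I, 1 − y f⟩ ⊆ k[xᵢ, y]` (`k` any commutative ring).
[cite: CoxLittleOShea2007, Ch.4 §2 Prop. 8] -/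
theorem mvPolynomial_mem_radical_iff_one_mem_rabinowitsch (I : Ideal (MvPolynomial σ k)) (f : MvPolynomial σ k) :
    f ∈ I.radical ↔ (1 : MvPolynomial (Option σ) k) ∈
      I.map (rename some : MvPolynomial σ k →ₐ[k] MvPolynomial (Option σ) k) ⊔
        Ideal.span {1 - X none * rename some f} := by
  rw [mem_radical_iff_one_mem_rabinowitsch, ← map_optionEquivLeft_rabinowitsch, Ideal.mem_map_of_equiv]
  constructor
  · rintro ⟨x, hx, hx1⟩
    have hx' : x = 1 := (optionEquivLeft k σ).injective (by rw [hx1, map_one])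
    exact hx' ▸ hx
  · exact fun h => ⟨1, h, map_one _⟩

end MvPolynomial

/-! ### Ch. 4 §1: `V(Ĩ) = ∅`, and Hilbert's Nullstellensatz from the Weak Nullstellensatz -/

section Field

variable {k : Type*} [Field k] {σ : Type*}

/-- **The claim `V(Ĩ) = ∅`** in the proof of Hilbert's Nullstellensatz (Cox–Little–O'Shea Ch. 4 §1
Thm. 2): if `f` vanishes at every common zero of `I` (in `kⁿ`), then `Ĩ = ⟨I, 1 − y f⟩` has no zero in
`kⁿ⁺¹` — at a point `(a, a_{n+1})` either some generator of `I` is nonzero, or `f(a) = 0` and then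
`1 − y f` takes the value `1 ≠ 0`. [cite: CoxLittleOShea2007, Ch.4 §1, proof of Thm. 2 (the claim V(Ĩ) = ∅)] -/
theorem zeroLocus_rabinowitsch_eq_empty (I : Ideal (MvPolynomial σ k))
    {f : MvPolynomial σ k} (hf : f ∈ vanishingIdeal k (zeroLocus k I)) :
    zeroLocus k (I.map (rename some : MvPolynomial σ k →ₐ[k] MvPolynomial (Option σ) k) ⊔
      Ideal.span {1 - X none * rename some f}) = ∅ := by
  refine Set.eq_empty_iff_forall_notMem.mpr fun b hb => ?_
  have ha : (b ∘ some) ∈ zeroLocus k I := fun p hp => by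
    have h := hb (rename some p) (Ideal.mem_sup_left (Ideal.mem_map_of_mem _ hp))
    rwa [aeval_rename] at h
  have h0 : aeval (b ∘ some) f = 0 := (mem_vanishingIdeal_iff.mp hf) _ ha
  have h1 := hb (1 - X none * rename some f) (Ideal.mem_sup_right (Ideal.subset_span rfl))
  rw [map_sub, map_one, map_mul, MvPolynomial.aeval_X, aeval_rename, h0, mul_zero, sub_zero] at h1
  exact one_ne_zero h1

/-- **Hilbert's Nullstellensatz from the Weak Nullstellensatz, by the book's trick** (Cox–Little–O'Shea
Ch. 4 §1, proof of Thm. 2): if every ideal of `k[x₁, …, xₙ, y]` without common zeros in `kⁿ⁺¹` is the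
whole ring (the Weak Nullstellensatz, Thm. 1, in `n + 1` variables — true for `k` algebraically closed),
then `f ∈ I(V(I)) ⇒ fᵐ ∈ I` for some `m`: indeed `V(Ĩ) = ∅` forces `1 ∈ Ĩ`, and Prop. 8 of §2 (eqs.
(2)–(4)) gives `fᵐ ∈ I`. (With Mathlib's Nullstellensatz supplying the hypothesis for `k` algebraically
closed and finitely many variables this recovers `MvPolynomial.vanishingIdeal_zeroLocus_eq_radical`, which
is not restated.) [cite: CoxLittleOShea2007, Ch.4 §1 Thm. 2 (Hilbert's Nullstellensatz, proof via Ĩ)] -/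
theorem mem_radical_of_weakNullstellensatz
    (hweak : ∀ J : Ideal (MvPolynomial (Option σ) k), zeroLocus k J = ∅ → J = ⊤)
    (I : Ideal (MvPolynomial σ k)) {f : MvPolynomial σ k}
    (hf : f ∈ vanishingIdeal k (zeroLocus k I)) : f ∈ I.radical := by
  rw [mvPolynomial_mem_radical_iff_one_mem_rabinowitsch,
    hweak _ (zeroLocus_rabinowitsch_eq_empty I hf)]
  exact Submodule.mem_top

/-- **The Weak Nullstellensatz** (Cox–Little–O'Shea Ch. 4 §1 Thm. 1) in the form used above: over an
algebraically closed field, an ideal of `k[x₁, …, xₙ]` with `V(I) = ∅` is the whole ring (from Mathlib's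
`MvPolynomial.vanishingIdeal_zeroLocus_eq_radical`: `√I = I(∅) = k[x]`).
[cite: CoxLittleOShea2007, Ch.4 §1 Thm. 1 (The Weak Nullstellensatz)] -/
theorem eq_top_of_zeroLocus_eq_empty [IsAlgClosed k] {τ : Type*} [Finite τ]
    (J : Ideal (MvPolynomial τ k)) (hJ : zeroLocus k J = ∅) : J = ⊤ := by
  have hrad := MvPolynomial.vanishingIdeal_zeroLocus_eq_radical (K := k) J
  rw [hJ, MvPolynomial.vanishingIdeal_empty, eq_comm, Ideal.radical_eq_top] at hrad
  exact hrad

/-- Hilbert's Nullstellensatz over an algebraically closed field, `n` finite, assembled along the book's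
route (Thm. 1 for `n + 1` variables ⇒ `V(Ĩ) = ∅ ⇒ 1 ∈ Ĩ ⇒ fᵐ ∈ I`): `f ∈ I(V(I)) ⇒ ∃ m, fᵐ ∈ I`.
[cite: CoxLittleOShea2007, Ch.4 §1 Thm. 2 (Hilbert's Nullstellensatz)] -/
theorem exists_pow_mem_of_mem_vanishingIdeal_zeroLocus [IsAlgClosed k] [Finite σ]
    (I : Ideal (MvPolynomial σ k)) {f : MvPolynomial σ k}
    (hf : f ∈ vanishingIdeal k (zeroLocus k I)) : ∃ m : ℕ, f ^ m ∈ I :=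
  Ideal.mem_radical_iff.mp
    (mem_radical_of_weakNullstellensatz
      (fun J hJ => eq_top_of_zeroLocus_eq_empty J hJ) I hf)

end Field

end Literature.RingTheory.Nullstellensatz.RadicalMembership
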